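import Mathlib
import HarnessLib.Audit
import Summits.PneNP.PneNP.Theorems.PstarChordReadTight
import Summits.PneNP.PneNP.Theorems.PstarChordReadPairCore

/-!
# O1 up to twelve outputs reduces to two slice-generic chords on twelve-output centre structures (ROUND-24, O1; memo g21 §16.6 / §17)

FRONTIER range-avoidance ladder, rung F-N3, ROUND 24 (cell `pnp-ideate`, prover-2 memos `g18/O1-SCOPING.md` §2, `g21/O1-CHORD-READ-g21.md` §16.6,
§17; typed target `PstarCoreBoundTargets.TerminalPeelable` (p646951); restricted-model proof complexity — nothing here bears on `P` versus `NP`).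

`TerminalPeelable` (O1) says the non-chords of a terminal core are leaf-peelable.  A counterexample carries a CENTRE CYCLE (a non-empty leafless set
of non-chords), which forces `#J₀ ≥ 12` (`PstarChordBridgeCentre.twelve_le_of_leafless_nonchords`).  This file closes the bookkeeping between that
threshold and the chord-read programme at the FIRST case `#J₀ = 12`:

* `twelve_le_two_mul_card_sharedSlots` — the same count, sharpened: a centre cycle forces SIX shared AND slots, `12 ≤ 2·#sharedSlots J₀` (so with
  the sharing bound R0, `2·#sharedSlots ≤ #J₀`, a twelve-output core with a centre cycle is at MAXIMAL SHARING, hence tight: `#bdry J₀ = 18`);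
* `sliceGeneric_of_no_pairCore'` — `PstarChordReadPairCore.sliceGeneric_of_no_pairCore` with the pair-core readers restricted to those the
  definition of `SliceGeneric` quantifies over (linear part avoiding the chord's privates);
* **`peelable_of_card_le_twelve`** — if every twelve-output terminal core at maximal sharing with a centre cycle has two distinct SLICE-GENERIC
  chords, then every terminal core with `#J₀ ≤ 12` has leaf-peelable non-chords (`PstarChordReadTight.false_of_maxSharing_two_generic` + the
  count + `peelable_nonchords_of_card_lt`);
* **`peelable_of_card_le_twelve_of_noPairCore`** — the same with "slice-generic" replaced by "no pair-core inside `J₀ ∖ c` for a menu reader avoiding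
  the chord's privates" (the typed (Ra) of `PstarChordReadPairCore`; by `PstarPairCoreNormal` a pair-core is a terminal sub-core of `J₀ ∖ c` or an
  even-cycle coincidence read by explicit path-sum descendants).

So O1 for cores of at most twelve outputs is EXACTLY the statement that the 1800 tight twelve-output centre structures carry two pair-core-free chords
for every legal menu (kit certificate j314774: at least five of the six chords, for every fibre class).  No Assumption A.
-/

set_option linter.dupNamespace false -- `Summit.PneNP.PneNP.…`: summit = sub-problem name (D-0017 single-conjunct layout)

open Finset Literature.Computability.Complexity
open Summit.PneNP.PneNP.Theorems.PstarTyped (Typed)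
open Summit.PneNP.PneNP.Theorems.PstarSALevel (varSet bdry BoundaryExpanding SimpleOverlap)
open Summit.PneNP.PneNP.Theorems.PstarCentreFree (vars_mem_varSet)
open Summit.PneNP.PneNP.Theorems.PstarChordEndgameTools (not_two_shared)
open Summit.PneNP.PneNP.Theorems.PstarCoreBound (XorClosed)
open Summit.PneNP.PneNP.Theorems.PstarXCore (xpair xverts mem_xpair)
open Summit.PneNP.PneNP.Theorems.PstarChordRepair (IsChord)
open Summit.PneNP.PneNP.Theorems.PstarSharingBound (mult sharedSlots mult_eq_one_of_mem_bdry two_mul_card_sharedSlots_le)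
open Summit.PneNP.PneNP.Theorems.PstarChordBridgeTools (xpdeg)
open Summit.PneNP.PneNP.Theorems.PstarChordBridgeCotree (Peelable mem_xverts_iff_xpdeg_pos card_xverts_le_of_leafless)
open Summit.PneNP.PneNP.Theorems.PstarNorUnitCoverTools (three_le_card_of_leafless)
open Summit.PneNP.PneNP.Theorems.PstarChordBridgeCentre (mem_sharedSlots mult_mono exists_shared_slot_of_not_isChord xorClosed_of_leafless
  exists_and_slot_of_mem peelable_nonchords_of_card_lt)
open Summit.PneNP.PneNP.Theorems.PstarCoreBoundTargets (Terminal nonchords mem_nonchords nonchords_subset)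
open Summit.PneNP.PneNP.Theorems.PstarGapOneAll (gval)
open Summit.PneNP.PneNP.Theorems.PstarGSat (gSat)
open Summit.PneNP.PneNP.Theorems.PstarChordReadsMirror (gval_pair)
open Summit.PneNP.PneNP.Theorems.PstarChordReadLemma (SliceGeneric)
open Summit.PneNP.PneNP.Theorems.PstarChordReadPairCore (PairCore phi_of_forall_ne)
open Summit.PneNP.PneNP.Theorems.PstarChordReadTight (false_of_maxSharing_two_generic)

namespace Summit.PneNP.PneNP.Theorems.PstarTerminalPeelableTwelve

variable {n m : ℕ}

/-! ## A centre cycle forces six shared slots -/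

/-- **A centre cycle forces six shared AND slots**: `12 ≤ 2·#sharedSlots J₀`.  The count of `PstarChordBridgeCentre.twelve_le_of_leafless_nonchords`
(adapted verbatim), with the conclusion kept one step sharper: there it is combined with R0 `2·#sharedSlots ≤ #J₀` to give `12 ≤ #J₀`. -/
theorem twelve_le_two_mul_card_sharedSlots (I : LocalMap 4 n m) (hI : I.IsPure xorAndPred) (hT : Typed I) (hS : SimpleOverlap I) {r : ℕ}
    (hB : BoundaryExpanding r I) {J₀ : Finset (Fin m)} (hr : J₀.card ≤ r) {S : Finset (Fin m)} (hSJ : S ⊆ J₀)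
    (hne : S.Nonempty) (hL : ∀ w ∈ xverts I S, 2 ≤ xpdeg I S w) (hnc : ∀ f ∈ S, ¬ IsChord I J₀ f) : 12 ≤ 2 * (sharedSlots I J₀).card := by
  classical
  have h4slot : ∀ t : Fin 4, 2 ≤ t.val → t = 2 ∨ t = 3 := by decide
  have hXS : XorClosed I S := xorClosed_of_leafless I hI hL
  have hSr : S.card ≤ r := (card_le_card hSJ).trans hr
  have htS : 2 * (sharedSlots I S).card ≤ S.card := two_mul_card_sharedSlots_le I S hXS (hB S hSr)
  -- `J₀`-shared slots inside / outside `S`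
  set XS := (sharedSlots I J₀).filter fun p => p.1 ∈ S with hXSdef
  set Xout := (sharedSlots I J₀).filter fun p => ¬ p.1 ∈ S with hXoutdef
  have hsplit : XS.card + Xout.card = (sharedSlots I J₀).card := card_filter_add_card_filter_not _
  -- slots shared inside `S` are `J₀`-shared slots inside `S`
  have hTsub : sharedSlots I S ⊆ XS := by
    intro p hp
    obtain ⟨hp1, hp2, hpm⟩ := mem_sharedSlots.1 hp
    exact mem_filter.2 ⟨mem_sharedSlots.2 ⟨hSJ hp1, hp2, hpm.trans (mult_mono I hSJ _)⟩, hp1⟩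
  -- every output of `S` owns a `J₀`-shared slot
  have hcov : S ⊆ XS.image Prod.fst := by
    intro f hf
    obtain ⟨s, hs2, hsm⟩ := exists_shared_slot_of_not_isChord I (hSJ hf) (hnc f hf)
    exact mem_image.2 ⟨(f, s), mem_filter.2 ⟨mem_sharedSlots.2 ⟨hSJ hf, hs2, hsm⟩, hf⟩, rfl⟩
  have hScard : S.card ≤ XS.card := (card_le_card hcov).trans card_image_le
  -- the externally shared slots of `S` inject into the shared slots outside `S`
  set E := XS \ sharedSlots I S with hEdef
  have hEcard : E.card = XS.card - (sharedSlots I S).card := card_sdiff_of_subset hTsub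
  have hTle : (sharedSlots I S).card ≤ XS.card := card_le_card hTsub
  have hEmem : ∀ p ∈ E, p.1 ∈ S ∧ 2 ≤ p.2.val ∧ 2 ≤ mult I J₀ (I.vars p.1 p.2) ∧ mult I S (I.vars p.1 p.2) ≤ 1 := by
    intro p hp
    rw [hEdef, mem_sdiff] at hp
    obtain ⟨hp, hpn⟩ := hp
    rw [hXSdef, mem_filter] at hp
    obtain ⟨hpJ, hp1⟩ := hp
    obtain ⟨-, hp2, hpm⟩ := mem_sharedSlots.1 hpJ
    refine ⟨hp1, hp2, hpm, ?_⟩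
    by_contra hlt
    exact hpn (mem_sharedSlots.2 ⟨hp1, hp2, by omega⟩)
  have hex : ∀ p ∈ E, ∃ q ∈ Xout, I.vars q.1 q.2 = I.vars p.1 p.2 := by
    intro p hp
    obtain ⟨hp1, hp2, hpm, hpS⟩ := hEmem p hp
    obtain ⟨g, hgJ, hgv, hgS⟩ : ∃ g ∈ J₀, I.vars p.1 p.2 ∈ varSet I g ∧ g ∉ S := by
      by_contra hno
      push Not at hno
      have hsub : (J₀.filter fun j => I.vars p.1 p.2 ∈ varSet I j) ⊆ S.filter fun j => I.vars p.1 p.2 ∈ varSet I j := by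
        intro j hj
        rw [mem_filter] at hj ⊢
        exact ⟨hno j hj.1 hj.2, hj.2⟩
      have := card_le_card hsub
      change mult I J₀ (I.vars p.1 p.2) ≤ mult I S (I.vars p.1 p.2) at this
      omega
    obtain ⟨s', hs', hgs'⟩ := exists_and_slot_of_mem I hT hp2 hgv
    refine ⟨(g, s'), mem_filter.2 ⟨mem_sharedSlots.2 ⟨hgJ, hs', ?_⟩, hgS⟩, hgs'⟩
    show 2 ≤ mult I J₀ (I.vars g s')
    rw [hgs']; exact hpm
  choose! φ hφ using hex
  have hinj : E.card ≤ Xout.card := by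
    refine card_le_card_of_injOn φ (fun p hp => (hφ p hp).1) ?_
    intro p hp p' hp' heq
    obtain ⟨hp1, hp2, -, hpS⟩ := hEmem p hp
    obtain ⟨hp'1, hp'2, -, -⟩ := hEmem p' hp'
    have hv : I.vars p.1 p.2 = I.vars p'.1 p'.2 := by rw [← (hφ p hp).2, ← (hφ p' hp').2, heq]
    have hf : p.1 = p'.1 := by
      have h1 : p.1 ∈ S.filter fun j => I.vars p.1 p.2 ∈ varSet I j := mem_filter.2 ⟨hp1, vars_mem_varSet I p.1 p.2⟩
      have h2 : p'.1 ∈ S.filter fun j => I.vars p.1 p.2 ∈ varSet I j := mem_filter.2 ⟨hp'1, hv ▸ vars_mem_varSet I p'.1 p'.2⟩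
      exact card_le_one.1 hpS _ h1 _ h2
    have hsl : p.2 = p'.2 := by
      by_contra hne
      have hne23 : I.vars p.1 2 ≠ I.vars p.1 3 := fun h => absurd (hI.2 p.1 h) (by decide)
      rw [← hf] at hv
      rcases h4slot p.2 hp2 with h | h <;> rcases h4slot p'.2 hp'2 with h' | h'
      · exact hne (h.trans h'.symm)
      · rw [h, h'] at hv; exact hne23 hv
      · rw [h, h'] at hv; exact hne23 hv.symm
      · exact hne (h.trans h'.symm)
    exact Prod.ext hf hsl
  -- arithmetic: `#shared(J₀) ≥ 2#S − #shared(S) ≥ 3#S/2`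
  have h3 := three_le_card_of_leafless I hI hS hne hL
  by_cases h4 : 4 ≤ S.card
  · omega
  · -- `#S = 3`: an XOR triangle has no AND sharing inside
    have hS3 : S.card = 3 := by omega
    have hXV : (xverts I S).card ≤ S.card := card_xverts_le_of_leafless I hL
    have ht0 : (sharedSlots I S).card = 0 := by
      rw [card_eq_zero, eq_empty_iff_forall_notMem]
      intro p hp
      obtain ⟨hp1, hp2, hpm⟩ := mem_sharedSlots.1 hp
      obtain ⟨f', hf'S, hne', hvf'⟩ : ∃ f' ∈ S, f' ≠ p.1 ∧ I.vars p.1 p.2 ∈ varSet I f' := by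
        obtain ⟨a, ha, b, hb, hab⟩ := one_lt_card.1 (show 1 < mult I S (I.vars p.1 p.2) by omega)
        rw [mem_filter] at ha hb
        by_cases haf : a = p.1
        · exact ⟨b, hb.1, fun h => hab (haf.trans h.symm), hb.2⟩
        · exact ⟨a, ha.1, haf, ha.2⟩
      have h01 : ∀ j, I.vars j 0 ≠ I.vars j 1 := fun j h => absurd (hI.2 j h) (by decide)
      have hcard2 : ∀ j, (xpair I j).card = 2 := fun j => by unfold PstarXCore.xpair; exact card_pair (h01 j)
      have hsub : xpair I p.1 ∪ xpair I f' ⊆ xverts I S := by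
        intro w hw
        unfold PstarXCore.xverts
        rw [mem_biUnion]
        rcases mem_union.1 hw with hw | hw
        · exact ⟨p.1, hp1, hw⟩
        · exact ⟨f', hf'S, hw⟩
      have hnd : ¬ Disjoint (xpair I p.1) (xpair I f') := by
        intro hd
        have := card_le_card hsub
        rw [card_union_of_disjoint hd, hcard2, hcard2] at this
        omega
      obtain ⟨w, hw, hw'⟩ := not_disjoint_iff.1 hnd
      have hwv : I.vars p.1 p.2 ≠ w := by
        rcases (mem_xpair I).1 hw with h | h
        · rw [h]; exact fun h' => hT p.1 p.1 0 p.2 (by decide) hp2 h'.symm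
        · rw [h]; exact fun h' => hT p.1 p.1 1 p.2 (by decide) hp2 h'.symm
      have hwS : ∀ {j}, w ∈ xpair I j → w ∈ varSet I j := fun hw => by
        rcases (mem_xpair I).1 hw with h | h
        · rw [h]; exact vars_mem_varSet I _ 0
        · rw [h]; exact vars_mem_varSet I _ 1
      exact not_two_shared I hS (Ne.symm hne') hwv (vars_mem_varSet I p.1 p.2) hvf' (hwS hw) (hwS hw')
    omega

/-- **A twelve-output XOR-closed family with a centre cycle is at maximal sharing**: `2·#sharedSlots J₀ = #J₀`. -/
theorem maxSharing_of_centre_twelve (I : LocalMap 4 n m) (hI : I.IsPure xorAndPred) (hT : Typed I) (hS : SimpleOverlap I) {r : ℕ}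
    (hB : BoundaryExpanding r I) {J₀ : Finset (Fin m)} (hX : XorClosed I J₀) (hr : J₀.card ≤ r) (hk : J₀.card = 12) {S : Finset (Fin m)}
    (hSJ : S ⊆ J₀) (hne : S.Nonempty) (hL : ∀ w ∈ xverts I S, 2 ≤ xpdeg I S w) (hnc : ∀ f ∈ S, ¬ IsChord I J₀ f) :
    2 * (sharedSlots I J₀).card = J₀.card := by
  have h₁ := twelve_le_two_mul_card_sharedSlots I hI hT hS hB hr hSJ hne hL hnc
  have h₂ := two_mul_card_sharedSlots_le I J₀ hX (hB J₀ hr)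
  omega

/-- **A non-peelable set of non-chords contains a centre cycle**: a non-empty leafless `S ⊆ nonchords`. -/
theorem exists_centre_of_not_peelable (I : LocalMap 4 n m) {J₀ : Finset (Fin m)} (h : ¬ Peelable I (nonchords I J₀)) :
    ∃ S ⊆ J₀, S.Nonempty ∧ (∀ w ∈ xverts I S, 2 ≤ xpdeg I S w) ∧ ∀ f ∈ S, ¬ IsChord I J₀ f := by
  unfold PstarChordBridgeCotree.Peelable at h
  push Not at h
  obtain ⟨S, hSsub, hne, hno⟩ := h
  refine ⟨S, hSsub.trans (nonchords_subset I J₀), hne, fun w hw => ?_, fun f hf => ((mem_nonchords I).1 (hSsub hf)).2⟩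
  have hpos := (mem_xverts_iff_xpdeg_pos I S w).1 hw
  have hne1 := hno w
  omega

/-! ## O1 up to twelve outputs from two generic chords -/
section Twelve

variable {I : LocalMap 4 n m} {r : ℕ}

/-- **O1 FOR CORES OF AT MOST TWELVE OUTPUTS REDUCES TO TWO SLICE-GENERIC CHORDS.**  If every twelve-output terminal core at maximal sharing carrying a
centre cycle (a non-empty leafless set of non-chords) has two distinct slice-generic chords (for the menu of its own readers), then the non-chords of
every terminal core with at most twelve outputs are leaf-peelable. -/
theorem peelable_of_card_le_twelve (hI : I.IsPure xorAndPred) (hT : Typed I) (hS : SimpleOverlap I) (hB : BoundaryExpanding r I)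
    (hgen : ∀ (y : Fin m → Bool) (J₀ : Finset (Fin m)) (w₁ w₂ : Finset (Fin n) × Finset (Fin m) × Bool), Terminal I r y J₀ w₁ w₂ →
      J₀.card = 12 → 2 * (sharedSlots I J₀).card = J₀.card →
      (∃ S ⊆ J₀, S.Nonempty ∧ (∀ w ∈ xverts I S, 2 ≤ xpdeg I S w) ∧ ∀ f ∈ S, ¬ IsChord I J₀ f) →
      ∃ cᵢ ∈ J₀, ∃ cⱼ ∈ J₀, cᵢ ≠ cⱼ ∧ IsChord I J₀ cᵢ ∧ IsChord I J₀ cⱼ ∧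
        SliceGeneric I y J₀ cᵢ (w₁.2.1 ∪ w₂.2.1) ∧ SliceGeneric I y J₀ cⱼ (w₁.2.1 ∪ w₂.2.1))
    {y : Fin m → Bool} {J₀ : Finset (Fin m)} {w₁ w₂ : Finset (Fin n) × Finset (Fin m) × Bool} (ht : Terminal I r y J₀ w₁ w₂)
    (hk : J₀.card ≤ 12) : Peelable I (nonchords I J₀) := by
  have hX : XorClosed I J₀ := ht.2.1
  have hr : J₀.card ≤ r := ht.2.2.1.le
  rcases Nat.lt_or_ge J₀.card 12 with hlt | hge
  · exact peelable_nonchords_of_card_lt I hI hT hS hB hX hr hlt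
  · have hk12 : J₀.card = 12 := le_antisymm hk hge
    by_contra hnp
    obtain ⟨S, hSJ, hne, hL, hnc⟩ := exists_centre_of_not_peelable I hnp
    have hmax := maxSharing_of_centre_twelve I hI hT hS hB hX hr hk12 hSJ hne hL hnc
    obtain ⟨cᵢ, hcᵢ, cⱼ, hcⱼ, hne', hchᵢ, hchⱼ, hgenᵢ, hgenⱼ⟩ := hgen y J₀ w₁ w₂ ht hk12 hmax ⟨S, hSJ, hne, hL, hnc⟩
    exact false_of_maxSharing_two_generic hI hT hS hB ht hmax hcᵢ hcⱼ hne' hchᵢ hchⱼ hgenᵢ hgenⱼ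

end Twelve

/-! ## Slice genericity from the absence of pair-cores whose reader avoids the chord's privates -/
section PairCores

variable {I : LocalMap 4 n m} {r : ℕ} {y : Fin m → Bool} {J₀ : Finset (Fin m)} {c : Fin m} {𝒢 : Finset (Fin m)}

/-- `PstarChordReadPairCore.sliceGeneric_of_no_pairCore` with the hypothesis restricted to the readers `SliceGeneric` actually quantifies over: those
whose linear part avoids the privates `vars c 2, vars c 3` of the chord (same proof). -/
theorem sliceGeneric_of_no_pairCore' (hI : I.IsPure xorAndPred) (hT : Typed I) (hS : SimpleOverlap I) (hB : BoundaryExpanding r I)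
    (hJr : J₀.card ≤ r) (hdisj : Disjoint J₀ 𝒢)
    (hno : ∀ K ⊆ J₀.erase c, ∀ (C : Finset (Fin n)) (G : Finset (Fin m)) (t b : Bool), I.vars c 2 ∉ C → I.vars c 3 ∉ C → G ⊆ 𝒢 →
      ¬ PairCore I y K c t (C, G, b)) :
    SliceGeneric I y J₀ c 𝒢 := by
  classical
  intro C G t b hp hq hG hfail
  have h01 : I.vars c 0 ≠ I.vars c 1 := fun h => absurd (hI.2 c h) (by decide)
  have hJr' : (J₀.erase c).card ≤ r := (card_le_card (erase_subset c J₀)).trans hJr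
  have hdisj' : Disjoint (J₀.erase c) G := (hdisj.mono_left (erase_subset c J₀)).mono_right hG
  have hGa : ∀ g ∈ G, I.vars g 2 ≠ I.vars c 0 ∧ I.vars g 3 ≠ I.vars c 0 :=
    fun g _ => ⟨fun e => hT c g 0 2 (by decide) (by decide) e.symm, fun e => hT c g 0 3 (by decide) (by decide) e.symm⟩
  have hGb : ∀ g ∈ G, I.vars g 2 ≠ I.vars c 1 ∧ I.vars g 3 ≠ I.vars c 1 :=
    fun g _ => ⟨fun e => hT c g 1 2 (by decide) (by decide) e.symm, fun e => hT c g 1 3 (by decide) (by decide) e.symm⟩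
  obtain ⟨x₁, hx₁, hx₁s⟩ : ∃ x : Fin n → Bool, (∀ j ∈ J₀.erase c, I.eval x j = y j) ∧ xor (x (I.vars c 0)) (x (I.vars c 1)) = t := by
    have hnc : ∃ u u' : Fin n → Bool, gval I {I.vars c 0, I.vars c 1} ∅ u ≠ gval I {I.vars c 0, I.vars c 1} ∅ u' := by
      refine ⟨fun v => decide (v = I.vars c 0), fun _ => false, ?_⟩
      rw [gval_pair I h01, gval_pair I h01]
      simp [h01.symm]
    obtain ⟨x, hx, hxab⟩ := gSat n m r I hI hT hB hS y (J₀.erase c) ∅ {I.vars c 0, I.vars c 1} t hJr' (disjoint_empty_right _) hnc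
    rw [gval_pair I h01] at hxab
    exact ⟨x, hx, hxab⟩
  by_cases hR : ∃ x : Fin n → Bool, (∀ j ∈ J₀.erase c, I.eval x j = y j) ∧ gval I C G x = b
  swap
  · push Not at hR
    have hconst : ∀ u u' : Fin n → Bool, gval I C G u = gval I C G u' := by
      by_contra hnc
      push Not at hnc
      obtain ⟨u, u', huu⟩ := hnc
      obtain ⟨x, hx, hxb⟩ := gSat n m r I hI hT hB hS y (J₀.erase c) G C b hJr' hdisj' ⟨u, u', huu⟩
      exact hR x hx hxb
    exact ⟨fun _ => gval I C G x₁, fun x => hconst x x₁⟩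
  obtain ⟨x₀, hx₀, hx₀b⟩ := hR
  set P : Finset (Finset (Fin m)) := (J₀.erase c).powerset.filter fun K =>
    ¬ ∃ x : Fin n → Bool, (∀ j ∈ K, I.eval x j = y j) ∧ xor (x (I.vars c 0)) (x (I.vars c 1)) = t ∧ gval I C G x = b with hP
  have hPne : P.Nonempty := ⟨J₀.erase c, mem_filter.2 ⟨mem_powerset.2 (Subset.refl _), fun ⟨x, hx, hxs, hxb⟩ => hfail x hx hxs hxb⟩⟩
  obtain ⟨K, hKP, hKmin⟩ := exists_min_image P Finset.card hPne
  rw [mem_filter, mem_powerset] at hKP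
  obtain ⟨hKsub, hKT3⟩ := hKP
  by_cases hKne : K.Nonempty
  · refine absurd ⟨hKne, hKT3, fun f hf => ?_, ⟨x₀, fun j hj => hx₀ j (hKsub hj), hx₀b⟩, ⟨x₁, fun j hj => hx₁ j (hKsub hj), hx₁s⟩⟩
      (hno K hKsub C G t b hp hq hG)
    by_contra hnw
    have hmem : K.erase f ∈ P := mem_filter.2 ⟨mem_powerset.2 ((erase_subset f K).trans hKsub), hnw⟩
    have := hKmin _ hmem
    rw [card_erase_of_mem hf] at this
    have hpos := card_pos.2 hKne
    omega
  · rw [not_nonempty_iff_eq_empty] at hKne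
    subst hKne
    exact phi_of_forall_ne hI hS h01 hGa hGb fun x hxs hxb => hKT3 ⟨x, fun j hj => absurd hj (notMem_empty j), hxs, hxb⟩

/-- **O1 FOR CORES OF AT MOST TWELVE OUTPUTS FROM THE ABSENCE OF PAIR-CORES.**  If on every twelve-output terminal core at maximal sharing with a
centre cycle two distinct chords `cᵢ, cⱼ` admit NO pair-core inside `J₀ ∖ c` for any reader drawn from the menu `G₁ ∪ G₂` whose linear part avoids
the chord's privates, then every terminal core with at most twelve outputs has leaf-peelable non-chords. -/
theorem peelable_of_card_le_twelve_of_noPairCore (hI : I.IsPure xorAndPred) (hT : Typed I) (hS : SimpleOverlap I) (hB : BoundaryExpanding r I)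
    (hno : ∀ (y : Fin m → Bool) (J₀ : Finset (Fin m)) (w₁ w₂ : Finset (Fin n) × Finset (Fin m) × Bool), Terminal I r y J₀ w₁ w₂ →
      J₀.card = 12 → 2 * (sharedSlots I J₀).card = J₀.card →
      (∃ S ⊆ J₀, S.Nonempty ∧ (∀ w ∈ xverts I S, 2 ≤ xpdeg I S w) ∧ ∀ f ∈ S, ¬ IsChord I J₀ f) →
      ∃ cᵢ ∈ J₀, ∃ cⱼ ∈ J₀, cᵢ ≠ cⱼ ∧ IsChord I J₀ cᵢ ∧ IsChord I J₀ cⱼ ∧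
        ∀ c ∈ ({cᵢ, cⱼ} : Finset (Fin m)), ∀ K ⊆ J₀.erase c, ∀ (C : Finset (Fin n)) (G : Finset (Fin m)) (t b : Bool),
          I.vars c 2 ∉ C → I.vars c 3 ∉ C → G ⊆ w₁.2.1 ∪ w₂.2.1 → ¬ PairCore I y K c t (C, G, b))
    {y : Fin m → Bool} {J₀ : Finset (Fin m)} {w₁ w₂ : Finset (Fin n) × Finset (Fin m) × Bool} (ht : Terminal I r y J₀ w₁ w₂)
    (hk : J₀.card ≤ 12) : Peelable I (nonchords I J₀) := by
  refine peelable_of_card_le_twelve hI hT hS hB (fun y J₀ w₁ w₂ ht hk12 hmax hS₀ => ?_) ht hk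
  obtain ⟨cᵢ, hcᵢ, cⱼ, hcⱼ, hne, hchᵢ, hchⱼ, hK⟩ := hno y J₀ w₁ w₂ ht hk12 hmax hS₀
  have hJr : J₀.card ≤ r := ht.2.2.1.le
  have hdisj : Disjoint J₀ (w₁.2.1 ∪ w₂.2.1) := disjoint_union_right.2 ⟨ht.2.2.2.1, ht.2.2.2.2.1⟩
  exact ⟨cᵢ, hcᵢ, cⱼ, hcⱼ, hne, hchᵢ, hchⱼ,
    sliceGeneric_of_no_pairCore' hI hT hS hB hJr hdisj (hK cᵢ (mem_insert_self _ _)),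
    sliceGeneric_of_no_pairCore' hI hT hS hB hJr hdisj (hK cⱼ (mem_insert_of_mem (mem_singleton_self _)))⟩

end PairCores

end Summit.PneNP.PneNP.Theorems.PstarTerminalPeelableTwelve
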